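import Mathlib
import HarnessLib
import Literature.AlgebraicGeometry.Resolution.RegularLocalOrderValuation
import Literature.AlgebraicGeometry.Resolution.RankOneReductionProofs
import Summits.ResolutionOfSingularities.ResolutionOfSingularities.Theorems.HomologicalConductorNoZenoSandwichClusterDefs

/-!
# Route `HomologicalConductor`, crux `NoZeno`/`NoZenoR` (stmt-ResolutionOfSingularities-16483 / -19943),
# line `sandwich-cluster`: `ordSet S` IS the order valuation ring of a regular local `S`

OURS (cell res-hironaka, crux chain W4.4, seat res-L0-w44-stub-3). Nothing here is a statement of the
manuscript under review (Hironaka 2017); AI-written, weaker than expert review.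

The dictionary of the line `sandwich-cluster` (CRUX-PLAN W4.4 v2 §2; vocabulary
`HomologicalConductorNoZenoSandwichClusterDefs.lean`) attaches to every regular 2-dimensional local
`k`-subalgebra `S` of `K` («infinitely near point `q`») the SET `ordSet S` of quotients `a * b⁻¹` with
`a, b ∈ 𝔪_Sⁿ`, `b ∉ 𝔪_Sⁿ⁺¹`, intended to be the valuation ring of the prime divisor `E_q`; the stubs S1–S4
(`basePts`, `Dominates (ordSet S) T`) only make geometric sense if this set IS a valuation ring of `K`.
This file proves it, for `S` REGULAR local with `Frac S = K`, from the tree brick «the `𝔪`-adic order of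
a regular local ring is additive» (`Literature.AlgebraicGeometry.Resolution.adicOrder_mul`, `ordAddVal`;
Zariski–Samuel II, Ch. VIII §1 Thm. 1: the order function of a regular local ring is a valuation):

* `mem_ordSet_iff`, `coe_mul_inv_mem_ordSet_iff` — `a * b⁻¹ ∈ ordSet S ↔ ord b ≤ ord a` (`b ≠ 0`);
* `mul_mem_ordSet`, `add_mem_ordSet`, `neg_mem_ordSet`, `mem_ordSet_or_inv_mem` — ring and valuation
  axioms; **`exists_valuationSubring_coe_eq_ordSet`**: `∃ V : ValuationSubring K, ↑V = ordSet S`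
  (stated as an existence theorem so that no new definition is introduced; users `obtain ⟨V, hV⟩`);
  `exists_valuationSubring_coe_eq_ordSet_of_le` — the same from `R ≤ S`, `Frac R = K`;
* `coe_subset_ordSet` (`S ⊆ ordSet S`), `inv_coe_mem_ordSet_iff`, `inv_coe_mem_ordSet_iff_isUnit`
  (**centre**: for `0 ≠ s ∈ S`, `s⁻¹ ∈ ordSet S ↔ s ∉ 𝔪_S`), `dominates_ordSet_self`;
* for `V` with `↑V = ordSet S`: `le_toSubring_of_coe_eq_ordSet` (`S ≤ V`), `valuation_coe_lt_one_iff`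
  (`v(s) < 1 ↔ s ∈ 𝔪_S`: the valuation is CENTRED at `𝔪_S`), `valuation_coe_eq_one_iff`,
  `ne_top_of_coe_eq_ordSet` (`𝔪_S ≠ 0 ⇒ V ≠ ⊤`), `eq_top_of_coe_eq_ordSet` (`S` a field ⇒ `V = ⊤`);
* `valuation_eq_one_iff_inv_mem_of_dominates` — under `Dominates ↑V T`, `v(t) = 1 ↔ t⁻¹ ∈ T` (`t ∈ T`);
* `maximalIdeal_ne_bot_of_ringKrullDim_eq_two`, and the packaged form for the stubs:
  **`exists_valuationSubring_of_mem_basePts`** — `S ∈ basePts R T` (`Frac R = K`) ⇒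
  `∃ V : ValuationSubring K, ↑V = ordSet S ∧ V ≠ ⊤ ∧ S ≤ V ∧ T ≤ V ∧ (V dominates T)`.

Not here (deliberately): DISCRETENESS of `V` (`V` is a DVR: companion file
`HomologicalConductorNoZenoOrdValuationDVR.lean`), the residue field of `V` (purely transcendental of degree `dim S − 1` over
`S/𝔪_S`, loc. cit. — not needed to STATE the stubs), and anything about non-regular or non-local `S`
(there `ordSet S` is just a set).  The general-local-ring domination lemma `inv_mem_of_inv_mem_ordSet` is
stub-2's (`HomologicalConductorNoZenoCapture.lean`, p477568); `dominates_ordSet_self` here is its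
regular case, proved independently through the centre.

References: O. Zariski, P. Samuel, *Commutative Algebra* II (1960), Ch. VIII §1, Thm. 1 and Corollary
[`ZariskiSamuel1960`]; M. Spivakovsky, Ann. of Math. 131 (1990) §II (the dictionary) [`Spivakovsky1990`].
-/

noncomputable section

-- single-problem summit: the doubled namespace component `ResolutionOfSingularities` is forced
set_option linter.dupNamespace false

namespace Summit.ResolutionOfSingularities.ResolutionOfSingularities.Theorems.NoZeno.SandwichCluster

variable {k K : Type} [Field k] [Field K] [Algebra k K]

open IsLocalRing Literature.AlgebraicGeometry.Resolution

section LocalRing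

variable (S : Subalgebra k K) [IsLocalRing ↥S]

/-- In a local subalgebra of a field the Jacobson radical of `⊥` is the maximal ideal. [folklore] -/
theorem jacobson_bot_eq_maximalIdeal : ((⊥ : Ideal ↥S).jacobson) = maximalIdeal ↥S :=
  IsLocalRing.jacobson_eq_maximalIdeal ⊥ bot_ne_top

/-- Unfolding `ordSet` over the maximal ideal. [folklore] -/
theorem mem_ordSet_iff_maximalIdeal {x : K} :
    x ∈ ordSet S ↔ ∃ n : ℕ, ∃ a b : ↥S, a ∈ maximalIdeal ↥S ^ n ∧ b ∈ maximalIdeal ↥S ^ n ∧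
      b ∉ maximalIdeal ↥S ^ (n + 1) ∧ x = (a : K) * ((b : K))⁻¹ := by
  simp only [ordSet, Set.mem_setOf_eq, jacobson_bot_eq_maximalIdeal]

end LocalRing

section Regular

variable (S : Subalgebra k K) [IsRegularLocalRing ↥S]

/-- **Membership in `ordSet S` by orders** (regular local `S`): `x ∈ ordSet S` iff `x = a/b` with
`a, b ∈ S`, `b ≠ 0`, `ord b ≤ ord a`. [cite: ZariskiSamuel1960, Ch. VIII §1 Thm. 1] -/
theorem mem_ordSet_iff {x : K} :
    x ∈ ordSet S ↔ ∃ a b : ↥S, b ≠ 0 ∧ adicOrder b ≤ adicOrder a ∧ x = (a : K) * ((b : K))⁻¹ := by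
  rw [mem_ordSet_iff_maximalIdeal]
  constructor
  · rintro ⟨n, a, b, ha, hb, hbn, rfl⟩
    refine ⟨a, b, ?_, ?_, rfl⟩
    · rintro rfl
      exact hbn (zero_mem _)
    · have hbo : adicOrder b ≤ (n : ℕ∞) := (adicOrder_le_iff b n).mpr hbn
      exact hbo.trans ((le_adicOrder_iff a n).mpr ha)
  · rintro ⟨a, b, hb0, hle, rfl⟩
    obtain ⟨n, hn⟩ := ENat.ne_top_iff_exists.mp (adicOrder_ne_top hb0)
    refine ⟨n, a, b, ?_, ?_, ?_, rfl⟩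
    · exact (le_adicOrder_iff a n).mp (hn.le.trans hle)
    · exact (le_adicOrder_iff b n).mp hn.le
    · exact (adicOrder_le_iff b n).mp hn.symm.le

/-- `a * b⁻¹ ∈ ordSet S ↔ ord b ≤ ord a` for `a, b ∈ S`, `b ≠ 0` (regular local `S`).
[cite: ZariskiSamuel1960, Ch. VIII §1 Thm. 1] -/
theorem coe_mul_inv_mem_ordSet_iff (a b : ↥S) (hb : b ≠ 0) :
    (a : K) * ((b : K))⁻¹ ∈ ordSet S ↔ adicOrder b ≤ adicOrder a := by
  haveI := isDomain_of_isRegularLocalRing (↥S)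
  rw [mem_ordSet_iff]
  constructor
  · rintro ⟨a', b', hb', hle, h⟩
    -- a/b = a'/b'  ⇒  a b' = a' b  ⇒  ord a + ord b' = ord a' + ord b
    have hbK : (b : K) ≠ 0 := fun h => hb (by exact_mod_cast h)
    have hb'K : (b' : K) ≠ 0 := fun h => hb' (by exact_mod_cast h)
    have hab : a * b' = a' * b := by
      have : (a : K) * (b' : K) = (a' : K) * (b : K) := by
        field_simp at h
        linear_combination h
      exact_mod_cast this
    have hord := congrArg adicOrder hab
    rw [adicOrder_mul, adicOrder_mul] at hord
    -- cancel in ℕ∞ using finiteness of ord b, ord b'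
    obtain ⟨p, hp⟩ := ENat.ne_top_iff_exists.mp (adicOrder_ne_top hb)
    obtain ⟨q, hq⟩ := ENat.ne_top_iff_exists.mp (adicOrder_ne_top hb')
    rw [← hp] ; rw [← hp, ← hq] at hord; rw [← hq] at hle
    rcases (eq_top_or_lt_top (adicOrder a)) with ha | ha
    · rw [ha]; exact le_top
    · obtain ⟨r, hr⟩ := ENat.ne_top_iff_exists.mp ha.ne
      rcases (eq_top_or_lt_top (adicOrder a')) with ha' | ha'
      · rw [ha', top_add] at hord
        rw [← hr] at hord
        exact absurd hord (by exact_mod_cast ENat.coe_ne_top (r + q))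
      · obtain ⟨r', hr'⟩ := ENat.ne_top_iff_exists.mp ha'.ne
        rw [← hr, ← hr'] at hord; rw [← hr'] at hle; rw [← hr]
        have h1 : r + q = r' + p := by exact_mod_cast hord
        have h2 : q ≤ r' := by exact_mod_cast hle
        exact_mod_cast (show p ≤ r by omega)
  · intro hle
    exact ⟨a, b, hb, hle, rfl⟩

/-- `S ⊆ ordSet S`. [folklore] -/
theorem coe_mem_ordSet (s : ↥S) : (s : K) ∈ ordSet S := by
  rw [mem_ordSet_iff]
  refine ⟨s, 1, one_ne_zero, ?_, by simp⟩
  rw [adicOrder_one]; exact zero_le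

/-- `0 ∈ ordSet S`. [folklore] -/
theorem zero_mem_ordSet : (0 : K) ∈ ordSet S := by
  simpa using coe_mem_ordSet S 0

/-- `1 ∈ ordSet S`. [folklore] -/
theorem one_mem_ordSet : (1 : K) ∈ ordSet S := by
  simpa using coe_mem_ordSet S 1

/-- `ordSet S` is closed under multiplication (regular local `S`: `ord` is additive).
[cite: ZariskiSamuel1960, Ch. VIII §1 Thm. 1] -/
theorem mul_mem_ordSet {x y : K} (hx : x ∈ ordSet S) (hy : y ∈ ordSet S) : x * y ∈ ordSet S := by
  haveI := isDomain_of_isRegularLocalRing (↥S)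
  rw [mem_ordSet_iff] at hx hy ⊢
  obtain ⟨a, b, hb, hab, rfl⟩ := hx
  obtain ⟨c, d, hd, hcd, rfl⟩ := hy
  refine ⟨a * c, b * d, mul_ne_zero hb hd, ?_, ?_⟩
  · rw [adicOrder_mul, adicOrder_mul]; exact add_le_add hab hcd
  · push_cast; ring

/-- `ordSet S` is closed under addition (`ord (ad + cb) ≥ min`). [cite: ZariskiSamuel1960, Ch. VIII §1 Thm. 1] -/
theorem add_mem_ordSet {x y : K} (hx : x ∈ ordSet S) (hy : y ∈ ordSet S) : x + y ∈ ordSet S := by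
  haveI := isDomain_of_isRegularLocalRing (↥S)
  rw [mem_ordSet_iff] at hx hy ⊢
  obtain ⟨a, b, hb, hab, rfl⟩ := hx
  obtain ⟨c, d, hd, hcd, rfl⟩ := hy
  have hbK : (b : K) ≠ 0 := fun h => hb (by exact_mod_cast h)
  have hdK : (d : K) ≠ 0 := fun h => hd (by exact_mod_cast h)
  refine ⟨a * d + c * b, b * d, mul_ne_zero hb hd, ?_, ?_⟩
  · rw [adicOrder_mul]
    refine le_trans ?_ (min_adicOrder_le_add _ _)
    rw [adicOrder_mul, adicOrder_mul, le_min_iff]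
    constructor
    · exact add_le_add hab le_rfl
    · rw [add_comm (adicOrder b) (adicOrder d)]; exact add_le_add hcd le_rfl
  · push_cast; field_simp

/-- `ord (-a) = ord a`. [folklore] -/
theorem adicOrder_neg (a : ↥S) : adicOrder (-a) = adicOrder a :=
  AddValuation.map_neg (ordAddVal (↥S)) a

/-- `ordSet S` is closed under negation. [folklore] -/
theorem neg_mem_ordSet {x : K} (hx : x ∈ ordSet S) : -x ∈ ordSet S := by
  rw [mem_ordSet_iff] at hx ⊢
  obtain ⟨a, b, hb, hab, rfl⟩ := hx
  refine ⟨-a, b, hb, ?_, ?_⟩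
  · rwa [adicOrder_neg]
  · push_cast; ring

/-- The valuation dichotomy: for `Frac S = K`, every `x ∈ K` has `x ∈ ordSet S` or `x⁻¹ ∈ ordSet S`.
[cite: ZariskiSamuel1960, Ch. VIII §1 Thm. 1 and Corollary] -/
theorem mem_ordSet_or_inv_mem [IsFractionRing ↥S K] (x : K) : x ∈ ordSet S ∨ x⁻¹ ∈ ordSet S := by
  haveI := isDomain_of_isRegularLocalRing (↥S)
  obtain ⟨a, b, hb, rfl⟩ := IsFractionRing.div_surjective (A := ↥S) x
  have hb0 : b ≠ 0 := nonZeroDivisors.ne_zero hb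
  by_cases ha0 : a = 0
  · left; subst ha0; simpa using zero_mem_ordSet S
  rcases le_total (adicOrder b) (adicOrder a) with h | h
  · left
    rw [div_eq_mul_inv]
    exact (coe_mul_inv_mem_ordSet_iff S a b hb0).mpr h
  · right
    rw [inv_div, div_eq_mul_inv]
    exact (coe_mul_inv_mem_ordSet_iff S b a ha0).mpr h

/-- **`ordSet S` is a valuation subring of `K`** for `S` regular local with `Frac S = K`: the
valuation ring of the `𝔪_S`-adic order valuation (the prime divisor of the first kind `E_S`).
[cite: ZariskiSamuel1960, Ch. VIII §1 Thm. 1 and Corollary] -/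
theorem exists_valuationSubring_coe_eq_ordSet [IsFractionRing ↥S K] :
    ∃ V : ValuationSubring K, (V : Set K) = ordSet S :=
  ⟨{ carrier := ordSet S
     mul_mem' := fun hx hy => mul_mem_ordSet S hx hy
     one_mem' := one_mem_ordSet S
     add_mem' := fun hx hy => add_mem_ordSet S hx hy
     zero_mem' := zero_mem_ordSet S
     neg_mem' := fun hx => neg_mem_ordSet S hx
     mem_or_inv_mem' := mem_ordSet_or_inv_mem S }, rfl⟩

/-- `S ⊆ ordSet S`. [folklore] -/
theorem coe_subset_ordSet : (S : Set K) ⊆ ordSet S := by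
  intro x hx
  exact coe_mem_ordSet S ⟨x, hx⟩

/-- **Centre of the order valuation**: for `0 ≠ s ∈ S`, `s⁻¹ ∈ ordSet S ↔ s ∉ 𝔪_S` (regular local `S`).
[cite: ZariskiSamuel1960, Ch. VIII §1 Thm. 1 and Corollary] -/
theorem inv_coe_mem_ordSet_iff (s : ↥S) (hs : s ≠ 0) :
    ((s : K))⁻¹ ∈ ordSet S ↔ s ∉ maximalIdeal ↥S := by
  have h := coe_mul_inv_mem_ordSet_iff S 1 s hs
  rw [OneMemClass.coe_one, one_mul, adicOrder_one] at h
  rw [h, ← Nat.cast_zero, adicOrder_le_iff, zero_add, pow_one]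

/-- Unit form of the centre: for `0 ≠ s ∈ S`, `s⁻¹ ∈ ordSet S ↔ IsUnit s`. [folklore] -/
theorem inv_coe_mem_ordSet_iff_isUnit (s : ↥S) (hs : s ≠ 0) :
    ((s : K))⁻¹ ∈ ordSet S ↔ IsUnit s := by
  rw [inv_coe_mem_ordSet_iff S s hs, IsLocalRing.notMem_maximalIdeal]

/-- `ordSet S` dominates `S` (regular local `S`): an element of `S` whose inverse lies in `ordSet S`
has its inverse in `S`. (The general local case is `inv_mem_of_inv_mem_ordSet`,
`HomologicalConductorNoZenoCapture.lean`.) [folklore] -/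
theorem dominates_ordSet_self : Dominates (ordSet S) S := by
  intro t ht
  refine ⟨coe_subset_ordSet S ht, fun hinv => ?_⟩
  by_cases ht0 : t = 0
  · subst ht0; simp
  have hu : IsUnit (⟨t, ht⟩ : ↥S) :=
    (inv_coe_mem_ordSet_iff_isUnit S ⟨t, ht⟩ (fun h => ht0 (congrArg Subtype.val h))).mp hinv
  obtain ⟨u, hu⟩ := hu
  have : ((u⁻¹ : (↥S)ˣ) : ↥S).val = t⁻¹ := by
    have hmul : (u : ↥S).val * ((u⁻¹ : (↥S)ˣ) : ↥S).val = 1 := by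
      rw [← Subalgebra.coe_mul, Units.mul_inv]; rfl
    rw [hu] at hmul
    exact (eq_inv_of_mul_eq_one_right hmul)
  rw [← this]
  exact ((u⁻¹ : (↥S)ˣ) : ↥S).property

/-! ## The order valuation ring `V` (`↑V = ordSet S`) : containment, centre, non-triviality -/

variable {S}

/-- `S ≤ V` for the order valuation ring `V`. [folklore] -/
theorem le_toSubring_of_coe_eq_ordSet (V : ValuationSubring K) (hV : (V : Set K) = ordSet S) :
    S.toSubring ≤ V.toSubring := by
  intro x hx
  have : x ∈ (V : Set K) := hV ▸ coe_subset_ordSet S hx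
  exact this

/-- **The order valuation is centred at `𝔪_S`**: for `s ∈ S`, `v(s) < 1 ↔ s ∈ 𝔪_S`.
[cite: ZariskiSamuel1960, Ch. VIII §1 Thm. 1 and Corollary] -/
theorem valuation_coe_lt_one_iff (V : ValuationSubring K) (hV : (V : Set K) = ordSet S) (s : ↥S) :
    V.valuation (s : K) < 1 ↔ s ∈ maximalIdeal ↥S := by
  by_cases hs : s = 0
  · subst hs
    simp
  have hsK : (s : K) ≠ 0 := fun h => hs (by exact_mod_cast h)
  have hv0 : 0 < V.valuation (s : K) := (Valuation.pos_iff _).mpr hsK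
  -- `s⁻¹ ∈ V ↔ 1 ≤ v s`
  have hinv : ((s : K))⁻¹ ∈ V ↔ 1 ≤ V.valuation (s : K) := by
    rw [← ValuationSubring.valuation_le_one_iff, map_inv₀, inv_le_one₀ hv0]
  have hinv' : ((s : K))⁻¹ ∈ V ↔ s ∉ maximalIdeal ↥S := by
    rw [← inv_coe_mem_ordSet_iff S s hs, ← hV]; rfl
  constructor
  · intro hlt
    by_contra hns
    exact (not_le.mpr hlt) (hinv.mp (hinv'.mpr hns))
  · intro hmem
    by_contra hnl
    exact (hinv'.mp (hinv.mpr (not_lt.mp hnl))) hmem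

/-- For `s ∈ S`: `v(s) = 1 ↔ s ∉ 𝔪_S` (units of `S` are exactly the elements of `S` of value `1`). [folklore] -/
theorem valuation_coe_eq_one_iff (V : ValuationSubring K) (hV : (V : Set K) = ordSet S) (s : ↥S) :
    V.valuation (s : K) = 1 ↔ s ∉ maximalIdeal ↥S := by
  have hle : V.valuation (s : K) ≤ 1 :=
    (ValuationSubring.valuation_le_one_iff V _).mpr (le_toSubring_of_coe_eq_ordSet V hV s.property)
  rw [← valuation_coe_lt_one_iff V hV s, not_lt]
  exact ⟨fun h => h.symm.le, fun h => le_antisymm hle h⟩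

/-- **Non-triviality**: the order valuation ring of a regular local `S` that is not a field is a proper
subring of `K` (`V ≠ ⊤`). [folklore] -/
theorem ne_top_of_coe_eq_ordSet (V : ValuationSubring K) (hV : (V : Set K) = ordSet S)
    (h : maximalIdeal ↥S ≠ ⊥) : V ≠ ⊤ := by
  obtain ⟨s, hs𝔪, hs0⟩ := Submodule.exists_mem_ne_zero_of_ne_bot h
  intro htop
  have hmem : ((s : K))⁻¹ ∈ (V : Set K) := by rw [htop]; exact ValuationSubring.mem_top _
  rw [hV, inv_coe_mem_ordSet_iff S s hs0] at hmem
  exact hmem hs𝔪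

/-- Conversely, if `S` is a field (`𝔪_S = 0`) then `ordSet S = K`. [folklore] -/
theorem eq_top_of_coe_eq_ordSet [IsFractionRing ↥S K] (V : ValuationSubring K)
    (hV : (V : Set K) = ordSet S) (h : maximalIdeal ↥S = ⊥) : V = ⊤ := by
  haveI := isDomain_of_isRegularLocalRing (↥S)
  refine top_unique fun x _ => ?_
  obtain ⟨a, b, hb, rfl⟩ := IsFractionRing.div_surjective (A := ↥S) x
  have hb0 : b ≠ 0 := nonZeroDivisors.ne_zero hb
  have hbu : b ∉ maximalIdeal ↥S := by rw [h]; simpa using hb0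
  have hordb : adicOrder b = 0 := adicOrder_of_isUnit (IsLocalRing.notMem_maximalIdeal.mp hbu)
  show _ ∈ (V : Set K)
  rw [hV, show algebraMap (↥S) K a / algebraMap (↥S) K b = (a : K) * ((b : K))⁻¹ from div_eq_mul_inv _ _,
    coe_mul_inv_mem_ordSet_iff S a b hb0, hordb]
  exact zero_le

/-- The `basePts` form of the hypothesis `Frac S = K`: any `S` between `R` and `K = Frac R` will do.
[cite: ZariskiSamuel1960, Ch. VIII §1 Thm. 1 and Corollary] -/
theorem exists_valuationSubring_coe_eq_ordSet_of_le (R S : Subalgebra k K) (hRS : R ≤ S)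
    [IsFractionRing ↥R K] [IsRegularLocalRing ↥S] :
    ∃ V : ValuationSubring K, (V : Set K) = ordSet S := by
  haveI := isFractionRing_subalgebra_of_le R S hRS
  exact exists_valuationSubring_coe_eq_ordSet S

end Regular

section Dominates

/-- Under domination, the elements of `T` of value one are exactly the units of `T`:
for `t ∈ T`, `t ≠ 0`, `v(t) = 1 ↔ t⁻¹ ∈ T`. [folklore] -/
theorem valuation_eq_one_iff_inv_mem_of_dominates (V : ValuationSubring K) (T : Subalgebra k K)
    (hdom : Dominates (V : Set K) T) {t : K} (ht : t ∈ T) (ht0 : t ≠ 0) :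
    V.valuation t = 1 ↔ t⁻¹ ∈ T := by
  have htV : t ∈ V := (hdom t ht).1
  have hle : V.valuation t ≤ 1 := (ValuationSubring.valuation_le_one_iff V t).mpr htV
  have hv0 : 0 < V.valuation t := (Valuation.pos_iff _).mpr ht0
  have hinv : t⁻¹ ∈ V ↔ 1 ≤ V.valuation t := by
    rw [← ValuationSubring.valuation_le_one_iff, map_inv₀, inv_le_one₀ hv0]
  constructor
  · intro h1
    exact (hdom t ht).2 (hinv.mpr h1.symm.le)
  · intro hinvT
    exact le_antisymm hle (hinv.mp ((hdom _ hinvT).1))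

end Dominates

section BasePts

variable {R T S : Subalgebra k K}

/-- A 2-dimensional regular local ring is not a field: `𝔪_S ≠ 0`. [folklore] -/
theorem maximalIdeal_ne_bot_of_ringKrullDim_eq_two [IsRegularLocalRing ↥S]
    (hdim : ringKrullDim ↥S = 2) : maximalIdeal ↥S ≠ ⊥ := by
  intro h
  have hF : IsField ↥S := IsLocalRing.isField_iff_maximalIdeal_eq.mpr h
  have h0 := ringKrullDim_eq_zero_of_isField hF
  rw [hdim] at h0
  exact absurd h0 (by norm_num)

/-- **A base point carries its prime divisor.**  For `S ∈ basePts R T` (`Frac R = K`) the order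
pseudo-valuation ring `ordSet S` IS a valuation subring `V` of `K`: proper (`V ≠ ⊤`), containing `S`
and `T`, and dominating `T` (an element of `T` invertible in `V` is invertible in `T`); by
`valuation_coe_lt_one_iff` it is centred on `S` at `𝔪_S`.  This is the object `E_q` of the line's
dictionary (CRUX-PLAN W4.4 v2 §2), now available to the provers of S1, S2, S4 as a Mathlib
`ValuationSubring`. [cite: ZariskiSamuel1960, Ch. VIII §1 Thm. 1 and Corollary] -/
theorem exists_valuationSubring_of_mem_basePts [IsFractionRing ↥R K] (hS : S ∈ basePts R T) :
    ∃ V : ValuationSubring K, (V : Set K) = ordSet S ∧ V ≠ ⊤ ∧ S.toSubring ≤ V.toSubring ∧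
      T.toSubring ≤ V.toSubring ∧ ∀ t ∈ T, t⁻¹ ∈ V → t⁻¹ ∈ T := by
  obtain ⟨hRS, hreg, hdim, -, hdom⟩ := hS
  haveI := hreg
  obtain ⟨V, hV⟩ := exists_valuationSubring_coe_eq_ordSet_of_le R S hRS
  refine ⟨V, hV, ne_top_of_coe_eq_ordSet V hV (maximalIdeal_ne_bot_of_ringKrullDim_eq_two hdim),
    le_toSubring_of_coe_eq_ordSet V hV, ?_, ?_⟩
  · intro t ht
    have h := (hdom t ht).1
    rw [← hV] at h
    exact h
  · intro t ht hinv
    exact (hdom t ht).2 (by rw [← hV]; exact hinv)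

end BasePts

end Summit.ResolutionOfSingularities.ResolutionOfSingularities.Theorems.NoZeno.SandwichCluster

end
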